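import Mathlib

/-!
# `DualUnipotentThreeHalves` (stmt-ValiantsHypothesis-24318) — the HALF-ISOTROPIC TWO-ROW HUB `W₂(S₁,S₂,K)`
# (val-idea-26 g8, lens (a) «Gerstenhaber-type nilpotent-subspace structure theory»; MEMO-g8-half-isotropic-hub.md)

Kernel instrument for ENEMY SPEC V34 §6 (QUESTION δ).  For a commutative ring `R`, an index type `n`, matrices
`S₁ S₂ J : Matrix n n R` and the block matrices (index `Fin 2 ⊕ n`)

  `hub S₁ S₂ J x = fromBlocks 0 (Γ x) (Φ x) 0`,  `Φ x = [x | Jx]` (an `n × 2` block),  `Γ x = [xᵀS₁ ; xᵀS₂]` (a `2 × n` block),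

we prove, SORRY-FREE and characteristic-free (skewness is used only through the ALTERNATING hypotheses
`x ⬝ᵥ S₁ *ᵥ x = 0`, `x ⬝ᵥ S₂ *ᵥ x = 0`, `x ⬝ᵥ (S₂ * J) *ᵥ x = 0`):

* `hub_pow_five` : every member of the species is nilpotent of index ≤ 5 (`(hub S₁ S₂ J x)^5 = 0`) — the space is NIL for
  ALL alternating data, the fourth port pairing `G = S₁J` being completely free («half isotropy», memo §2.1/§2.5);
* `hub_prod_five_eq_zero` : the cheap direction of the Bipartite Reduction Lemma for `k = 2` (memo Thm 1, design branch):
  if five parameters `u 0, …, u 4` are pairwise isotropic for the three forms `S₁, S₂, K = S₂J`, the product of the five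
  hub matrices vanishes — so the span of a common isotropic subspace generates a nilpotent algebra (is triangularisable);
* `trace_hub_sq_sq` : the even-word trace identity `tr((A_u A_v)²) = tr(N(u,v)²) + tr(N(v,u)²)`, `N(u,v) = Γ u * Φ v`,
  the first obstruction used in the other direction of Thm 1.

HONEST LABEL.  Elementary block-matrix algebra about ONE explicit species; the generic lower bound
`δ_T(W₂) ≥ ⌈(3c−9)/5⌉` (incidence count) and Levitzki's theorem stay on paper (memo §1–§2).  Nothing here proves any case of
(c) `SlowCore.LongMassSlowLawInv`, of 24318, S3 or R2ᵖ; `VP ≠ VNP` is NOT proved.  No named facts, no new axioms.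
-/

set_option linter.dupNamespace false

namespace Summit.ValiantsHypothesis.ValiantsHypothesis.Cruxes.DualUnipotentThreeHalves.HalfIsotropicHub

open Matrix
open scoped BigOperators

variable {R : Type*} [CommRing R] {n : Type*} [Fintype n] [DecidableEq n]

/-- The `n × 2` block `Φ x = [x | Jx]`. -/
def Φ (J : Matrix n n R) (x : n → R) : Matrix n (Fin 2) R :=
  Matrix.of fun i c => (![x, J *ᵥ x] : Fin 2 → n → R) c i

/-- The `2 × n` block `Γ x = [xᵀS₁ ; xᵀS₂]`. -/
def Γ (S₁ S₂ : Matrix n n R) (x : n → R) : Matrix (Fin 2) n R :=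
  Matrix.of (![x ᵥ* S₁, x ᵥ* S₂] : Fin 2 → n → R)

/-- The hub matrix `A_x = [[0, Γ x], [Φ x, 0]]` on `Fin 2 ⊕ n`. -/
def hub (S₁ S₂ J : Matrix n n R) (x : n → R) : Matrix (Fin 2 ⊕ n) (Fin 2 ⊕ n) R :=
  Matrix.fromBlocks 0 (Γ S₁ S₂ x) (Φ J x) 0

/-- The `2 × 2` return matrix `N(x,y) = Γ x * Φ y`. -/
def N (S₁ S₂ J : Matrix n n R) (x y : n → R) : Matrix (Fin 2) (Fin 2) R := Γ S₁ S₂ x * Φ J y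

/-- The elementary matrix `g • E₀₁`. -/
def E01 (g : R) : Matrix (Fin 2) (Fin 2) R := Matrix.of fun a c => if a = 0 ∧ c = 1 then g else 0

lemma E01_mul_E01 (g g' : R) : E01 g * E01 g' = (0 : Matrix (Fin 2) (Fin 2) R) := by
  ext a c
  fin_cases a <;> fin_cases c <;> simp [E01, Matrix.mul_apply]

omit [DecidableEq n] in
/-- `tr (A B; C D) = tr A + tr D` (folklore). -/
lemma trace_fromBlocks₂ (A : Matrix (Fin 2) (Fin 2) R) (B : Matrix (Fin 2) n R) (C : Matrix n (Fin 2) R)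
    (D : Matrix n n R) : (Matrix.fromBlocks A B C D).trace = A.trace + D.trace := by
  simp [Matrix.trace, Fintype.sum_sum_type]

omit [DecidableEq n] in
/-- Entries of the return matrix: the four port pairings `S₁(x,y)`, `G(x,y) = xᵀS₁Jy`, `S₂(x,y)`, `xᵀS₂Jy`. -/
lemma N_apply (S₁ S₂ J : Matrix n n R) (x y : n → R) (a c : Fin 2) :
    N S₁ S₂ J x y a c = (![x ᵥ* S₁, x ᵥ* S₂] : Fin 2 → n → R) a ⬝ᵥ (![y, J *ᵥ y] : Fin 2 → n → R) c := by
  simp [N, Γ, Φ, Matrix.mul_apply, dotProduct]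

omit [DecidableEq n] in
/-- `xᵀ S (J y) = xᵀ (S J) y`. -/
lemma vecMul_dotProduct_mulVec (S J : Matrix n n R) (x y : n → R) :
    x ᵥ* S ⬝ᵥ J *ᵥ y = x ⬝ᵥ (S * J) *ᵥ y := by
  rw [Matrix.dotProduct_mulVec, Matrix.vecMul_vecMul, Matrix.dotProduct_mulVec]

section design
/-! ### The design branch: pairwise isotropic parameters give `N = G • E₀₁`. -/

omit [DecidableEq n] in
/-- If `S₁(x,y) = S₂(x,y) = K(x,y) = 0` (`K = S₂J`) then `N(x,y) = G(x,y) • E₀₁`. -/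
lemma N_eq_E01 (S₁ S₂ J : Matrix n n R) (x y : n → R)
    (h₁ : x ⬝ᵥ S₁ *ᵥ y = 0) (h₂ : x ⬝ᵥ S₂ *ᵥ y = 0) (hK : x ⬝ᵥ (S₂ * J) *ᵥ y = 0) :
    N S₁ S₂ J x y = E01 (x ᵥ* S₁ ⬝ᵥ J *ᵥ y) := by
  ext a c
  fin_cases a <;> fin_cases c
  · simpa [N_apply, E01, Matrix.dotProduct_mulVec] using h₁
  · simp [N_apply, E01]
  · simpa [N_apply, E01, Matrix.dotProduct_mulVec] using h₂
  · simpa [N_apply, E01, vecMul_dotProduct_mulVec] using hK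

end design

/-! ### Nilpotency of every member: `A_x ^ 5 = 0`. -/

lemma hub_mul_hub (S₁ S₂ J : Matrix n n R) (x y : n → R) :
    hub S₁ S₂ J x * hub S₁ S₂ J y = Matrix.fromBlocks (N S₁ S₂ J x y) 0 0 (Φ J x * Γ S₁ S₂ y) := by
  simp [hub, N, Matrix.fromBlocks_multiply]

/-- `A_x² = diag(N(x,x), Φ_x Γ_x)` with `N(x,x) = G(x,x) • E₀₁` for alternating data. -/
lemma hub_sq (S₁ S₂ J : Matrix n n R) (x : n → R)
    (h₁ : x ⬝ᵥ S₁ *ᵥ x = 0) (h₂ : x ⬝ᵥ S₂ *ᵥ x = 0) (hK : x ⬝ᵥ (S₂ * J) *ᵥ x = 0) :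
    hub S₁ S₂ J x * hub S₁ S₂ J x
      = Matrix.fromBlocks (E01 (x ᵥ* S₁ ⬝ᵥ J *ᵥ x)) 0 0 (Φ J x * Γ S₁ S₂ x) := by
  rw [hub_mul_hub, N_eq_E01 S₁ S₂ J x x h₁ h₂ hK]

/-- **Every member of the half-isotropic two-row hub is nilpotent of index ≤ 5** (for ALL alternating data). -/
theorem hub_pow_five (S₁ S₂ J : Matrix n n R) (x : n → R)
    (h₁ : x ⬝ᵥ S₁ *ᵥ x = 0) (h₂ : x ⬝ᵥ S₂ *ᵥ x = 0) (hK : x ⬝ᵥ (S₂ * J) *ᵥ x = 0) :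
    hub S₁ S₂ J x ^ 5 = 0 := by
  set g : R := x ᵥ* S₁ ⬝ᵥ J *ᵥ x with hg
  have hN : Γ S₁ S₂ x * Φ J x = E01 g := by
    simpa [N] using N_eq_E01 S₁ S₂ J x x h₁ h₂ hK
  have h2 := hub_sq S₁ S₂ J x h₁ h₂ hK
  -- A^4 = (A^2)^2 = diag(E01 g * E01 g, (ΦΓ)(ΦΓ)) = diag(0, Φ (ΓΦ) Γ)
  have h4 : hub S₁ S₂ J x ^ 4
      = Matrix.fromBlocks 0 0 0 (Φ J x * Γ S₁ S₂ x * (Φ J x * Γ S₁ S₂ x)) := by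
    rw [show (4 : ℕ) = 2 + 2 from rfl, pow_add, pow_two, h2, Matrix.fromBlocks_multiply]
    simp [E01_mul_E01]
  rw [pow_succ, h4, hub, Matrix.fromBlocks_multiply]
  -- lower-left block: Φ Γ Φ Γ Φ = Φ (ΓΦ)(ΓΦ) = Φ · E01 g · E01 g = 0
  have hPP : Φ J x * Γ S₁ S₂ x * (Φ J x * Γ S₁ S₂ x) * Φ J x = 0 := by
    calc Φ J x * Γ S₁ S₂ x * (Φ J x * Γ S₁ S₂ x) * Φ J x
        = Φ J x * ((Γ S₁ S₂ x * Φ J x) * (Γ S₁ S₂ x * Φ J x)) := by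
          simp only [Matrix.mul_assoc]
      _ = 0 := by rw [hN, E01_mul_E01, Matrix.mul_zero]
  simp [hPP]

/-- Hence nilpotent. -/
theorem hub_isNilpotent (S₁ S₂ J : Matrix n n R) (x : n → R)
    (h₁ : x ⬝ᵥ S₁ *ᵥ x = 0) (h₂ : x ⬝ᵥ S₂ *ᵥ x = 0) (hK : x ⬝ᵥ (S₂ * J) *ᵥ x = 0) :
    IsNilpotent (hub S₁ S₂ J x) := ⟨5, hub_pow_five S₁ S₂ J x h₁ h₂ hK⟩

/-- For GLOBALLY alternating data (`S₁`, `S₂`, `S₂J` alternating) the whole linear family is nil; since `hub` is linear in `x`,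
this is nil-ness of the SPACE `W₂ = {hub x}` (sums of members are members). -/
theorem hub_nil_of_alternating (S₁ S₂ J : Matrix n n R)
    (h₁ : ∀ x : n → R, x ⬝ᵥ S₁ *ᵥ x = 0) (h₂ : ∀ x : n → R, x ⬝ᵥ S₂ *ᵥ x = 0)
    (hK : ∀ x : n → R, x ⬝ᵥ (S₂ * J) *ᵥ x = 0) (x : n → R) :
    hub S₁ S₂ J x ^ 5 = 0 := hub_pow_five S₁ S₂ J x (h₁ x) (h₂ x) (hK x)

omit [DecidableEq n] in
/-- Linearity of the family in the parameter (so `{hub x : x}` is a linear space of matrices). -/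
lemma hub_add (S₁ S₂ J : Matrix n n R) (x y : n → R) :
    hub S₁ S₂ J (x + y) = hub S₁ S₂ J x + hub S₁ S₂ J y := by
  ext i j
  rcases i with a | i <;> rcases j with c | j
  · simp [hub]
  · fin_cases a <;> simp [hub, Γ, Matrix.add_vecMul]
  · fin_cases c <;> simp [hub, Φ, Matrix.mulVec_add]
  · simp [hub]

omit [DecidableEq n] in
lemma hub_smul (S₁ S₂ J : Matrix n n R) (t : R) (x : n → R) :
    hub S₁ S₂ J (t • x) = t • hub S₁ S₂ J x := by
  ext i j
  rcases i with a | i <;> rcases j with c | j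
  · simp [hub]
  · fin_cases a <;> simp [hub, Γ, Matrix.smul_vecMul]
  · fin_cases c <;> simp [hub, Φ, Matrix.mulVec_smul]
  · simp [hub]

/-! ### The cheap direction of the Bipartite Reduction Lemma (k = 2, design branch). -/

omit [DecidableEq n] in
/-- **Design branch of Thm 1 (k = 2).**  If the parameters `u 0, …, u 4` are pairwise isotropic for `S₁`, `S₂` and
`K = S₂J`, then `A_{u 0} A_{u 1} A_{u 2} A_{u 3} A_{u 4} = 0`.  (So the span of a common isotropic subspace of the three
skew forms generates an algebra with `alg^5 = 0`, i.e. is simultaneously triangularisable; the free fourth pairing `G = S₁J`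
does not obstruct.) -/
theorem hub_prod_five_eq_zero (S₁ S₂ J : Matrix n n R) (u : Fin 5 → n → R)
    (h₁ : ∀ i j, u i ⬝ᵥ S₁ *ᵥ u j = 0) (h₂ : ∀ i j, u i ⬝ᵥ S₂ *ᵥ u j = 0)
    (hK : ∀ i j, u i ⬝ᵥ (S₂ * J) *ᵥ u j = 0) :
    hub S₁ S₂ J (u 0) * hub S₁ S₂ J (u 1) * hub S₁ S₂ J (u 2) * hub S₁ S₂ J (u 3) * hub S₁ S₂ J (u 4) = 0 := by
  have hN : ∀ i j, Γ S₁ S₂ (u i) * Φ J (u j) = E01 (u i ᵥ* S₁ ⬝ᵥ J *ᵥ u j) := fun i j => by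
    simpa [N] using N_eq_E01 S₁ S₂ J (u i) (u j) (h₁ i j) (h₂ i j) (hK i j)
  -- A₀A₁ = diag(N₀₁, Φ₀Γ₁); ·A₂ = offdiag; ·A₃ = diag(N₀₁N₂₃, Φ₀N₁₂Γ₃); ·A₄ = offdiag with blocks N₀₁N₂₃Γ₄ and Φ₀N₁₂N₃₄
  simp only [hub, Matrix.fromBlocks_multiply, Matrix.mul_zero, Matrix.zero_mul, add_zero, zero_add]
  have hA : Γ S₁ S₂ (u 0) * Φ J (u 1) * Γ S₁ S₂ (u 2) * Φ J (u 3) * Γ S₁ S₂ (u 4) = 0 := by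
    calc Γ S₁ S₂ (u 0) * Φ J (u 1) * Γ S₁ S₂ (u 2) * Φ J (u 3) * Γ S₁ S₂ (u 4)
        = (Γ S₁ S₂ (u 0) * Φ J (u 1)) * (Γ S₁ S₂ (u 2) * Φ J (u 3)) * Γ S₁ S₂ (u 4) := by
          simp only [Matrix.mul_assoc]
      _ = 0 := by rw [hN 0 1, hN 2 3, E01_mul_E01, Matrix.zero_mul]
  have hB : Φ J (u 0) * Γ S₁ S₂ (u 1) * Φ J (u 2) * Γ S₁ S₂ (u 3) * Φ J (u 4) = 0 := by
    calc Φ J (u 0) * Γ S₁ S₂ (u 1) * Φ J (u 2) * Γ S₁ S₂ (u 3) * Φ J (u 4)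
        = Φ J (u 0) * ((Γ S₁ S₂ (u 1) * Φ J (u 2)) * (Γ S₁ S₂ (u 3) * Φ J (u 4))) := by
          simp only [Matrix.mul_assoc]
      _ = 0 := by rw [hN 1 2, hN 3 4, E01_mul_E01, Matrix.mul_zero]
  simp [hA, hB]

/-! ### The even-word trace identity (first obstruction in the other direction of Thm 1). -/

/-- `tr((A_u A_v)²) = tr(N(u,v)²) + tr(N(v,u)²)`. -/
theorem trace_hub_sq_sq (S₁ S₂ J : Matrix n n R) (u v : n → R) :
    Matrix.trace ((hub S₁ S₂ J u * hub S₁ S₂ J v) ^ 2)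
      = Matrix.trace (N S₁ S₂ J u v ^ 2) + Matrix.trace (N S₁ S₂ J v u ^ 2) := by
  rw [pow_two, pow_two, pow_two, hub_mul_hub, Matrix.fromBlocks_multiply]
  simp only [Matrix.mul_zero, Matrix.zero_mul, add_zero, zero_add, trace_fromBlocks₂]
  congr 1
  -- tr(Φ_u Γ_v Φ_u Γ_v) = tr(Γ_v Φ_u Γ_v Φ_u) = tr(N(v,u)²)
  rw [N, Matrix.mul_assoc, Matrix.trace_mul_comm]
  simp only [Matrix.mul_assoc]

/-- If `{A_w : w ∈ U}` is simultaneously triangularisable then in particular `tr((A_uA_v)²) = 0`; by the identity above this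
reads `tr(N(u,v)²) + tr(N(v,u)²) = 0` — e.g. for `u, v` isotropic for `S₁, S₂` but not for `K` it equals `2·K(u,v)²`
(memo §1, exact check `rank2hub_check.py` (3a)).  Recorded as the shape of the obstruction; the full converse is Levitzki. -/
theorem trace_obstruction (S₁ S₂ J : Matrix n n R) (u v : n → R)
    (h : Matrix.trace ((hub S₁ S₂ J u * hub S₁ S₂ J v) ^ 2) = 0) :
    Matrix.trace (N S₁ S₂ J u v ^ 2) + Matrix.trace (N S₁ S₂ J v u ^ 2) = 0 := by
  rw [← trace_hub_sq_sq]; exact h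

omit [DecidableEq n] in
/-- Traces of squares of the return matrices when `S₁`, `S₂` vanish on the pair: only `K = S₂J` survives. -/
lemma trace_N_sq_of_isotropic (S₁ S₂ J : Matrix n n R) (u v : n → R)
    (h₁ : u ⬝ᵥ S₁ *ᵥ v = 0) (h₂ : u ⬝ᵥ S₂ *ᵥ v = 0) :
    Matrix.trace (N S₁ S₂ J u v ^ 2) = (u ⬝ᵥ (S₂ * J) *ᵥ v) ^ 2 := by
  rw [Matrix.dotProduct_mulVec] at h₁ h₂
  simp [Matrix.trace, Fin.sum_univ_two, pow_two, Matrix.mul_apply, N_apply, h₁, h₂, vecMul_dotProduct_mulVec]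

/-- **The third form matters.**  If `u, v` are isotropic for `S₁` and `S₂` (both orders) then
`tr((A_uA_v)²) = K(u,v)² + K(v,u)²` (`= 2K(u,v)²` for skew `K`): unless also `K(u,v) = 0`, the pair `A_u, A_v` has a
trace word of nonzero trace and is NOT simultaneously triangularisable (memo §1 check (3a)). -/
theorem trace_hub_sq_sq_of_isotropic (S₁ S₂ J : Matrix n n R) (u v : n → R)
    (h₁ : u ⬝ᵥ S₁ *ᵥ v = 0) (h₁' : v ⬝ᵥ S₁ *ᵥ u = 0) (h₂ : u ⬝ᵥ S₂ *ᵥ v = 0) (h₂' : v ⬝ᵥ S₂ *ᵥ u = 0) :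
    Matrix.trace ((hub S₁ S₂ J u * hub S₁ S₂ J v) ^ 2)
      = (u ⬝ᵥ (S₂ * J) *ᵥ v) ^ 2 + (v ⬝ᵥ (S₂ * J) *ᵥ u) ^ 2 := by
  rw [trace_hub_sq_sq, trace_N_sq_of_isotropic S₁ S₂ J u v h₁ h₂, trace_N_sq_of_isotropic S₁ S₂ J v u h₁' h₂']

end Summit.ValiantsHypothesis.ValiantsHypothesis.Cruxes.DualUnipotentThreeHalves.HalfIsotropicHub
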